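import Literature.AlgebraicGeometry.Frobenioids.FiberProducts
import HarnessLib

/-!
# Frobenioids I, Proposition 1.6 (vi), clause «Aut^sub-ample», direction `C ⇒ C′` — the printed
# clause as a named statement (FALSE AS PRINTED; abc-iut finding F-w5d202-1)

Mochizuki, *The geometry of Frobenioids I: the general theory*, Kyushu J. Math. **62** (2008)
293–400, §1, Proposition 1.6 (vi), kurims text p. 27 [cite: MochizukiFrdI2008, Prop. 1.6(vi) p.27]:

> "(vi) A object of `C′` is Aut-ample (respectively, Aut^sub-ample; End-ample) if it projects to
> such an object of `C`."

Here `C′ := C ×_D D′` for a Frobenioid `C → F_Φ` over `D` and a functor `D′ → D` between connected,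
totally epimorphic categories mapping FSM-morphisms to FSM-morphisms (hypotheses of Prop. 1.6, p. 27);
`C′`, its pre-Frobenioid structure and the clauses «Aut-ample», «End-ample» of (vi) are
abc-iut-found's `FiberProducts*.lean` (`PreFrobenioid.isAutAmple_fiberProduct_of_fst`,
`PreFrobenioid.isEndAmple_fiberProduct_of_fst`), where the clause «Aut^sub-ample» was deliberately
left untyped (`FiberProductsMorphisms.lean`, module docstring: "the evident lifting argument needs … a
sub-automorphism of the `C`-component with PRESCRIBED projection to `D`").  This file only NAMES that
printed clause as a closed statement (same shape as `Prop16vMetricallyTrivialIf` of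
`FiberProductsMetricallyTrivialStatement.lean`, RULING P1 of the abc-iut cell) so that its refutation
can be recorded against it: it is FALSE AS PRINTED — kernel witness
`AutSubAmpleCex.not_prop16viAutSubAmpleIf` (`AutSubAmpleFiberProductCounterexample.lean`: a model
Frobenioid over a three-object base with lexicographic-cone divisor monoids, base-changed along a wide
subcategory).  Consumers must NOT bind it as a hypothesis.  What survives: the clause holds whenever
the lift of the base sub-automorphism to `A` can be chosen ISOMETRIC (pull-back + cartesian lift,
Def. 1.3 (i)(c), Prop. 1.4 (iii)) — e.g. at `Aut`-ample `A`, or where sub-automorphisms of `A` are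
isometric (the repaired Prop. 1.12 (ii) under the non-expanding hypotheses of RULING P12-NE).  The
author's *Comments* on [FrdI] (Jan 2024) do not touch Prop. 1.6.  Nothing here bears on [IUTchIII]
Cor. 3.12.
-/

namespace Literature.AlgebraicGeometry.Frobenioids

open CategoryTheory Opposite

namespace PreFrobenioid

/-- FALSE AS PRINTED (abc-iut finding F-w5d202-1; refuted by `AutSubAmpleCex.not_prop16viAutSubAmpleIf`):
**Prop. 1.6 (vi), «Aut^sub-ample», direction `C ⇒ C′`** as a closed statement (universe `0`) — for every
Frobenioid `C → F_Φ` over `D`, every functor `G : D′ → D` from a connected, totally epimorphic `D′`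
mapping FSM-morphisms to FSM-morphisms, and every object `A′` of `C′ = C ×_D D′`: if `A′` projects to an
`Aut^sub`-ample object of `C`, then `A′` is `Aut^sub`-ample in `C′`. Do NOT use as a hypothesis.
[cite: MochizukiFrdI2008, Prop. 1.6(vi) p.27] -/
def Prop16viAutSubAmpleIf : Prop :=
  ∀ {D : Type} [Category.{0} D] {D' : Type} [Category.{0} D'] {Φ : Dᵒᵖ ⥤ CommMonCat.{0}}
    {C : Type} [Category.{0} C] (F : C ⥤ ElemFrobenioid Φ) (G : D' ⥤ D),
    IsFrobenioid F → IsGraphConnected D' → IsTotallyEpimorphic D' →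
    (∀ {a b : D'} (f : a ⟶ b), IsFSM f → IsFSM (G.map f)) →
    ∀ A' : FiberProduct F G, IsAutSubAmple F A'.fst → IsAutSubAmple (fiberProductFunctor F G) A'

end PreFrobenioid

end Literature.AlgebraicGeometry.Frobenioids
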